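import Summits.AnomalousDissipation.AnomalousDissipation.Theses.MarginalStabilityChain
import Literature.Analysis.FluidPDE.StretchedLayerNS
import HarnessLib

/-!
# Crux `MarginalStabilityChain.StrainedLayerLaw` (stmt-AnomalousDissipation-3007): objects, transfer and
# conditional composition of the line `strain-work-sum-rule`

Support file (`--supports stmt-AnomalousDissipation-3007`): definitions plus SORRY-FREE transfer and composition, so
that the line's REGISTERED STUBS — landed one by one as `--supports` files under `Theorems/` — and the lead's checked
skeleton (`Cruxes/StrainedLayerLaw/Lines/strain_work_sum_rule.lean`, a crux workfile, not importable) speak about the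
SAME declarations (continuation lead `prover-line-stmt-AnomalousDissipation-3007-c1-0`, 2026-08-16; statements are the
planner's checked skeleton `planner-cruxplan-stmt-AnomalousDissipation-3007-strain-work-sum-rule-0`, v2, as reshaped by
the lead — reshape 1: the pair-kernel stub is split into the elementary moment identity `J = −∫∫ yωu` and the
Biot–Savart step `−∫∫ yωu = ½K_L[ω]`; the tails stub concludes tails on compact time intervals `[a, b] ⊂ (0, ∞)`
only; the floor stub also receives local finiteness of the dissipation). Contents:

* §0 objects of the line: `strainWork` (`J = ½∫∫(¼ − u² + v²)`), `excessEnergy` (`E = ½∫∫(u² + v² − ¼)`),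
  `vorticity`, `strainMoment` (`∫∫ yωu`), `pairKernel` (`K_L`), `pairForm` (`K_L[ω]`), the tails predicates
  `SliceTails` / `ExpTails`, and the crux's vocabulary VERBATIM: `IsAdmissible L θ₁ θ₂` (the five `θ`-clauses) and
  `InCruxClass ν L θ₁ θ₂ u v p` (the hypothesis list of `StrainedLayerLaw` on `(u, v, p)`, character for character,
  so that the crux's hypothesis and `InCruxClass` agree by `rfl`); glue `InCruxClass.isSolution`;
* §1 the FLOOR TRANSFER `floorTransfer` (abstract Cesàro lemma in `ℝ≥0∞`, proved);
* §2 the CONDITIONAL composition `StrainedLayerLaw_of_sumRuleStubs` (proved): its six hypotheses are, verbatim, the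
  statements of the six registered stubs (`stub_strainWorkIdentity`, `stub_strainWorkMoment`, `stub_momentPairKernel`,
  `stub_bareClassTails`, `stub_excessEnergySublinear`, `stub_concentrationFloor`) and its conclusion is the crux BY NAME.

No facts are asserted here: the stubs live in the skeleton / the stub files. Design choice: `strainWork`,
`excessEnergy`, `strainMoment`, `pairForm` are ITERATED Bochner integrals `∫ x in Ioc 0 L, ∫ y, …` (matching the
iterated structure of `layerDissipation`; junk `0` where not integrable — every use is under tails hypotheses that
make them honest integrals).

References: route file `Theses/MarginalStabilityChain.lean` (item 3007); `Literature/Analysis/FluidPDE/StretchedLayerNS.lean`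
(`IsStretchedLayerNSSolutionOn`, `StretchedLayer.dX/dY/lap/dT`, `layerDissipation`, `meanLayerDissipation`); line card
`Cruxes/StrainedLayerLaw/Lines/strain-work-sum-rule.md`; Majda–Bertozzi 2002 §1.4 (the stretched 2-D class),
Davidson 2001 p.179 (`γΓ²/8π`, the diagonal value of `K_L`).
-/

-- `Summit.<Summit>.<Problem>` is the tree's mandated summit-side namespace (CONVENTIONS §2); for this
-- single-conjunct summit the two coincide, so the duplicate is deliberate.
set_option linter.dupNamespace false

noncomputable section

open scoped Topology ENNReal
open Filter Set Function MeasureTheory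

namespace Summit.AnomalousDissipation.AnomalousDissipation.Theorems.StrainedLayerLaw.StrainWorkSumRule

open Literature.Analysis.FluidPDE Literature.Analysis.FluidPDE.StretchedLayer
open Summit.AnomalousDissipation.AnomalousDissipation.Theses.MarginalStabilityChain

/-! ## §0 Objects of the line -/

/-- **Strain work** of a plane slice (`ΔU = 1`, period `L`): `J(u,v) = ½ ∫_{x ∈ (0,L]} ∫_y (¼ − u² + v²)`
(iterated Bochner integrals). Derivative-free and `ν`-free; `= ∫∫v² − E`; `= −∫∫ yωu` under shear tails
(`stub_strainWorkMoment`). [folklore] -/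
def strainWork (L : ℝ) (u v : ℝ → ℝ → ℝ) : ℝ :=
  ∫ x in Ioc 0 L, ∫ y, (1 / 4 - u x y ^ 2 + v x y ^ 2) / 2

/-- **Excess planar energy** of a slice relative to the free streams `u = ±½`: `E = ½ ∫_{x ∈ (0,L]} ∫_y (u² + v² − ¼)`.
[folklore] -/
def excessEnergy (L : ℝ) (u v : ℝ → ℝ → ℝ) : ℝ :=
  ∫ x in Ioc 0 L, ∫ y, (u x y ^ 2 + v x y ^ 2 - 1 / 4) / 2

/-- Vorticity of a plane slice, `ω = ∂ₓv − ∂_yu` (slice derivatives `dX`, `dY` of `StretchedLayerNS`, i.e. Mathlib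
`deriv` of the partial maps — the crux's `Dx`, `Dy`). The layer's vorticity is NEGATIVE (`−U_B′`). [folklore] -/
def vorticity (u v : ℝ → ℝ → ℝ) (x y : ℝ) : ℝ :=
  dX v x y - dY u x y

/-- **First `y`-moment of `ωu`** over one period strip: `∫_{x ∈ (0,L]} ∫_y y·ω(x,y)·u(x,y)` (iterated Bochner
integrals). Under shear tails `J = −strainMoment` (two integrations by parts) and `strainMoment = −½K_L[ω]`
(cylinder Biot–Savart). [folklore] -/
def strainMoment (L : ℝ) (u v : ℝ → ℝ → ℝ) : ℝ :=
  ∫ x in Ioc 0 L, ∫ y, y * vorticity u v x y * u x y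

/-- **The strain-work pair kernel** of period `L`:
`K_L(δx, δy) = δy sinh(2πδy/L) / (2L (cosh(2πδy/L) − cos(2πδx/L)))` — nonnegative, even, `L`-periodic in `δx`;
`∫₀ᴸ K_L(δx, δy) dδx = |δy|/2`; near `0`, `K_L ≈ δy²/(2π|δ|²)` (angular mean `1/4π`); junk value `0` on the lattice
`(Lℤ, 0)` (Lean `x/0 = 0`, a null set). [folklore] -/
def pairKernel (L δx δy : ℝ) : ℝ :=
  δy * Real.sinh (2 * Real.pi * δy / L) /
    (2 * L * (Real.cosh (2 * Real.pi * δy / L) - Real.cos (2 * Real.pi * δx / L)))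

/-- **Circulation-concentration functional** `K_L[ω] = ∫∫_{cell} ∫∫_{cell} ω(ζ) ω(ζ′) K_L(ζ − ζ′)`
(cell = one period `(0,L] × ℝ`; iterated Bochner integrals). One round core of circulation `Γ` ↦ `Γ²/4π`; an
`x`-independent sheet `ω = −g(y)` ↦ `(L/2)∫∫ g g′ |y − y′|`. [folklore] -/
def pairForm (L : ℝ) (ω : ℝ → ℝ → ℝ) : ℝ :=
  ∫ x in Ioc 0 L, ∫ y, ∫ x' in Ioc 0 L, ∫ y', ω x y * ω x' y' * pairKernel L (x - x') (y - y')

/-- **Shear tails of a slice** with constants `C, k`: the deviation of `u² + v²` from `¼`, `v`, the velocity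
gradient and the Laplacians decay like `C e^{−k|y|}`, uniformly in `x`. [folklore] -/
def SliceTails (C k : ℝ) (u v : ℝ → ℝ → ℝ) : Prop :=
  ∀ x y : ℝ,
    |u x y ^ 2 + v x y ^ 2 - 1 / 4| ≤ C * Real.exp (-k * |y|) ∧
    |v x y| ≤ C * Real.exp (-k * |y|) ∧
    |dX u x y| + |dY u x y| + |dX v x y| + |dY v x y| ≤ C * Real.exp (-k * |y|) ∧
    |lap u x y| + |lap v x y| ≤ C * Real.exp (-k * |y|)

/-- **Uniform exponential shear tails on a time set `S`**: one pair of constants `C, k > 0` serves every slice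
`t ∈ S`, and the (one-sided, within `(0,∞)`) time derivatives decay as well. GAUGE-INVARIANT: no clause on the
pressure (in the class `p` is fixed only up to an additive `c(t)`; the decay of `∇p` follows from the momentum
equations inside the proofs that need it). [folklore] -/
def ExpTails (S : Set ℝ) (u v : ℝ → ℝ → ℝ → ℝ) : Prop :=
  ∃ C k : ℝ, 0 < k ∧ ∀ t ∈ S, SliceTails C k (u t) (v t) ∧
    ∀ x y : ℝ, |dT (Ioi 0) u t x y| + |dT (Ioi 0) v t x y| ≤ C * Real.exp (-k * |y|)

/-- **Admissible perturbations of period `L`, verbatim** (the five `θ`-clauses of the crux): `θ₁, θ₂ ∈ C²(ℝ²)`,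
`L`-periodic in `x`, vanishing for `|y| ≥ R`, and `∂ₓθ₁ + ∂_yθ₂ = 0`. [folklore] -/
def IsAdmissible (L : ℝ) (θ₁ θ₂ : ℝ → ℝ → ℝ) : Prop :=
  ContDiff ℝ 2 (fun q : ℝ × ℝ => θ₁ q.1 q.2) ∧ ContDiff ℝ 2 (fun q : ℝ × ℝ => θ₂ q.1 q.2) ∧
  (∀ x y, θ₁ (x + L) y = θ₁ x y ∧ θ₂ (x + L) y = θ₂ x y) ∧
  (∃ R : ℝ, ∀ x y, R ≤ |y| → θ₁ x y = 0 ∧ θ₂ x y = 0) ∧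
  (∀ x y, deriv (fun s => θ₁ s y) x + deriv (fun s => θ₂ x s) y = 0)

/-- **The crux's solution class, verbatim** (`γ = ΔU = 1`, period `L`, viscosity `ν`, datum `U_B^ν + θ`): the
hypothesis list of `StrainedLayerLaw` on `(u, v, p)`, copied symbol by symbol so that the composition below concludes
the crux by definitional unfolding (`u, v ∈ C²`, `p ∈ C¹` on `t > 0`, `u, v` continuous up to `t = 0`, the stretched
2-D Navier–Stokes system pointwise for `t > 0`, the three fields `L`-periodic in `x` for `t ≥ 0`, pointwise shear far
field for `t ≥ 0`, data `U_B^ν + θ₁`, `θ₂`). [folklore] -/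
def InCruxClass (ν L : ℝ) (θ₁ θ₂ : ℝ → ℝ → ℝ) (u v p : ℝ → ℝ → ℝ → ℝ) : Prop :=
  let Dt : (ℝ → ℝ → ℝ → ℝ) → ℝ → ℝ → ℝ → ℝ := fun f t x y => deriv (fun s => f s x y) t; let Dx : (ℝ → ℝ → ℝ → ℝ) → ℝ → ℝ → ℝ → ℝ := fun f t x y => deriv (fun s => f t s y) x; let Dy : (ℝ → ℝ → ℝ → ℝ) → ℝ → ℝ → ℝ → ℝ := fun f t x y => deriv (fun s => f t x s) y; let UB : ℝ → ℝ := fun y => (Real.sqrt (2 * Real.pi * ν))⁻¹ * ∫ s in (0:ℝ)..y, Real.exp (-(s ^ 2) / (2 * ν)); (ContDiffOn ℝ 2 (fun q : ℝ × ℝ × ℝ => u q.1 q.2.1 q.2.2) (Set.Ioi 0 ×ˢ Set.univ) ∧ ContDiffOn ℝ 2 (fun q : ℝ × ℝ × ℝ => v q.1 q.2.1 q.2.2) (Set.Ioi 0 ×ˢ Set.univ) ∧ ContDiffOn ℝ 1 (fun q : ℝ × ℝ × ℝ => p q.1 q.2.1 q.2.2) (Set.Ioi 0 ×ˢ Set.univ)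 ∧ ContinuousOn (fun q : ℝ × ℝ × ℝ => u q.1 q.2.1 q.2.2) (Set.Ici 0 ×ˢ Set.univ) ∧ ContinuousOn (fun q : ℝ × ℝ × ℝ => v q.1 q.2.1 q.2.2) (Set.Ici 0 ×ˢ Set.univ) ∧ (∀ t x y, 0 < t → Dt u t x y + u t x y * Dx u t x y + (v t x y - y) * Dy u t x y = -Dx p t x y + ν * (Dx (Dx u) t x y + Dy (Dy u) t x y) ∧ Dt v t x y + u t x y * Dx v t x y + (v t x y - y) * Dy v t x y - v t x y = -Dy p t x y + ν * (Dx (Dx v) t x y + Dy (Dy v) t x y) ∧ Dx u t x y + Dy v t x y = 0) ∧ (∀ t x y, 0 ≤ t → u t (x + L) y = u t x y ∧ v t (x + L) y = v t x y ∧ p t (x + L) y = p t x y) ∧ (∀ t x, 0 ≤ t → Tendsto (fun y => u t x y) atTop (nhds (1 / 2)) ∧ Tendsto (fun y => u t x y) atBot (nhds (-(1 / 2))) ∧ Tendsto (fun y => v t x y) atTop (nhds 0) ∧ Tendsto (fun y => v t x y) atBot (nhds 0)) ∧ (∀ x y, u 0 x y = UB y + θ₁ x y ∧ v 0 x y = θ₂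 x y))

/-- A member of the crux's class is a classical solution of the Literature structure on the open time set `(0, ∞)`
(`γ = ΔU = 1`): the crux's two-sided `deriv` in `t` is the one-sided `dT (Ioi 0)` there, `1 * y = y`, and the slice
derivatives agree definitionally. [folklore] -/
theorem InCruxClass.isSolution {ν L : ℝ} {θ₁ θ₂ : ℝ → ℝ → ℝ} {u v p : ℝ → ℝ → ℝ → ℝ}
    (h : InCruxClass ν L θ₁ θ₂ u v p) : IsStretchedLayerNSSolutionOn (Ioi 0) ν 1 1 L u v p := by
  obtain ⟨hu, hv, hp, -, -, hpde, hper, hfar, -⟩ := h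
  refine
    { contDiffOn_u := hu
      contDiffOn_v := hv
      contDiffOn_p := hp
      momentum_x := ?_
      momentum_y := ?_
      divFree := fun t ht x y => (hpde t x y ht).2.2
      periodic_u := fun t ht x y => (hper t x y (le_of_lt ht)).1
      periodic_v := fun t ht x y => (hper t x y (le_of_lt ht)).2.1
      periodic_p := fun t ht x y => (hper t x y (le_of_lt ht)).2.2
      tendsto_u_atTop := fun t ht x => (hfar t x (le_of_lt ht)).1
      tendsto_u_atBot := fun t ht x => (hfar t x (le_of_lt ht)).2.1
      tendsto_v_atTop := fun t ht x => (hfar t x (le_of_lt ht)).2.2.1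
      tendsto_v_atBot := fun t ht x => (hfar t x (le_of_lt ht)).2.2.2 }
  · intro t ht x y
    rw [dT_of_isOpen isOpen_Ioi u ht, one_mul]
    exact (hpde t x y ht).1
  · intro t ht x y
    rw [dT_of_isOpen isOpen_Ioi v ht, one_mul, one_mul]
    exact (hpde t x y ht).2.1

/-! ## §1 The floor transfer (abstract Cesàro lemma, proved) -/

/-- **Floor transfer.** For any `D : ℝ → [0,∞]` and real `J, E, K` (`L > 0`): if local finiteness of `∫₀ᵀ D`
forces (i) the sum rule `L·∫₁ᵀ D = ∫₁ᵀ J − (E(T) − E(1))` for `T > 1`, (ii) an eventual floor `(LK − ε)T ≤ ∫₁ᵀ J` and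
(iii) `E(T) ≤ εT` eventually, for every `ε > 0`, then `ofReal K ≤ liminf_T ofReal T⁻¹ ∫⁻₀ᵀ D` in `[0,∞]`.
(If some `∫⁻₀^{T₀} D = ⊤` the Cesàro means are eventually `⊤`; otherwise `T⁻¹∫₀ᵀ D ≥ T⁻¹∫₁ᵀ D ≥ K − δ` eventually for
every `δ > 0`, then `δ → 0⁺`.) Planner's `floorTransfer_proof`, verbatim. [folklore] -/
theorem floorTransfer (L K : ℝ) (D : ℝ → ℝ≥0∞) (J E : ℝ → ℝ) (hL : 0 < L)
    (h : (∀ T : ℝ, 0 < T → ∫⁻ t in Ioc 0 T, D t ≠ ∞) →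
      (∀ T : ℝ, 1 < T →
        L * (∫⁻ t in Ioc 1 T, D t).toReal = (∫ t in (1:ℝ)..T, J t) - (E T - E 1)) ∧
      (∀ ε : ℝ, 0 < ε → ∀ᶠ T in atTop, (L * K - ε) * T ≤ ∫ t in (1:ℝ)..T, J t) ∧
      (∀ ε : ℝ, 0 < ε → ∀ᶠ T in atTop, E T ≤ ε * T)) :
    ENNReal.ofReal K ≤ liminf (fun T : ℝ => ENNReal.ofReal T⁻¹ * ∫⁻ t in Ioc 0 T, D t) atTop := by
  by_cases hfin : ∀ T : ℝ, 0 < T → ∫⁻ t in Ioc 0 T, D t ≠ ∞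
  swap
  · -- some initial dissipation integral is infinite: the Cesàro means are eventually `⊤`
    push Not at hfin
    obtain ⟨T₀, hT₀, htop⟩ := hfin
    have hev : ∀ᶠ T in atTop, ENNReal.ofReal T⁻¹ * ∫⁻ t in Ioc 0 T, D t = (⊤ : ℝ≥0∞) := by
      filter_upwards [eventually_ge_atTop T₀] with T hT
      have hmono : ∫⁻ t in Ioc 0 T₀, D t ≤ ∫⁻ t in Ioc 0 T, D t :=
        lintegral_mono_set (Ioc_subset_Ioc_right hT)
      rw [htop, top_le_iff] at hmono
      rw [hmono, ENNReal.mul_top]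
      exact (ENNReal.ofReal_pos.mpr (inv_pos.mpr (hT₀.trans_le hT))).ne'
    rw [Filter.liminf_congr hev, Filter.liminf_const]
    exact le_top
  · obtain ⟨hId, hJ, hE⟩ := h hfin
    have key : ∀ δ : ℝ, 0 < δ → ENNReal.ofReal (K - δ) ≤
        liminf (fun T : ℝ => ENNReal.ofReal T⁻¹ * ∫⁻ t in Ioc 0 T, D t) atTop := by
      intro δ hδ
      set ε : ℝ := δ * L / 4 with hεdef
      have hε : 0 < ε := by positivity
      refine le_liminf_of_le (h := ?_)
      filter_upwards [hJ ε hε, hE ε hε, eventually_gt_atTop (1:ℝ),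
        eventually_ge_atTop (-(2 * E 1) / (L * δ))] with T hJT hET hT1 hTE
      have hT0 : 0 < T := one_pos.trans hT1
      have hsub : Ioc 1 T ⊆ Ioc 0 T := Ioc_subset_Ioc_left zero_le_one
      have hI_le : ∫⁻ t in Ioc 1 T, D t ≤ ∫⁻ t in Ioc 0 T, D t := lintegral_mono_set hsub
      have hI_ne : ∫⁻ t in Ioc 1 T, D t ≠ ∞ := ne_top_of_le_ne_top (hfin T hT0) hI_le
      have hid := hId T hT1
      have hreal : (K - δ) * T ≤ (∫⁻ t in Ioc 1 T, D t).toReal := by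
        have h1 : L * K * T - 2 * ε * T + E 1 ≤ L * (∫⁻ t in Ioc 1 T, D t).toReal := by
          rw [hid]; linarith
        have hTE' : -(2 * E 1) ≤ L * δ * T := by
          have h' := hTE
          rw [div_le_iff₀ (by positivity)] at h'
          linarith
        have h2 : L * ((K - δ) * T) ≤ L * (∫⁻ t in Ioc 1 T, D t).toReal := by
          rw [hεdef] at h1
          nlinarith [h1, hTE']
        exact le_of_mul_le_mul_left h2 hL
      have hKδ : ENNReal.ofReal (K - δ) = ENNReal.ofReal T⁻¹ * ENNReal.ofReal ((K - δ) * T) := by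
        rw [← ENNReal.ofReal_mul (inv_nonneg.mpr hT0.le)]
        congr 1
        field_simp
      calc ENNReal.ofReal (K - δ)
          = ENNReal.ofReal T⁻¹ * ENNReal.ofReal ((K - δ) * T) := hKδ
        _ ≤ ENNReal.ofReal T⁻¹ * ENNReal.ofReal ((∫⁻ t in Ioc 1 T, D t).toReal) := by gcongr
        _ = ENNReal.ofReal T⁻¹ * ∫⁻ t in Ioc 1 T, D t := by rw [ENNReal.ofReal_toReal hI_ne]
        _ ≤ ENNReal.ofReal T⁻¹ * ∫⁻ t in Ioc 0 T, D t := by gcongr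
    have htend : Tendsto (fun δ : ℝ => ENNReal.ofReal (K - δ)) (𝓝[>] 0)
        (𝓝 (ENNReal.ofReal K)) := by
      have h1 : Tendsto (fun δ : ℝ => K - δ) (𝓝 (0:ℝ)) (𝓝 (K - 0)) :=
        tendsto_const_nhds.sub tendsto_id
      rw [sub_zero] at h1
      exact (ENNReal.tendsto_ofReal h1).mono_left nhdsWithin_le_nhds
    refine le_of_tendsto htend ?_
    filter_upwards [self_mem_nhdsWithin] with δ hδ
    exact key δ hδ

/-! ## §2 The CONDITIONAL composition (proved): the six registered stub statements prove the crux BY NAME -/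

/-- **Conditional composition (kernel-checked, sorry-free): the six stub statements prove the crux BY NAME.**
Take `c`, `ν₀`, `θ` from the concentration floor (`h5`); for a member of the crux's class apply `floorTransfer` to
`D(t) = layerDissipation`, `J = strainWork`, `E = excessEnergy`: under local finiteness of the dissipation the tails
stub (`h3`) gives uniform shear tails on every `[a, b] ⊂ (0, ∞)`, the identity (`h1`) gives the sum rule on `[1, T]`,
the moment identity (`h2a`) and the pair-kernel representation (`h2b`) turn the `K_L`-floor of `h5` into the
`J`-floor, and the energy stub (`h4`) gives `E(T) ≤ εT`; the crux's inlined class and dissipation are these objects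
by `rfl`. [folklore] -/
theorem StrainedLayerLaw_of_sumRuleStubs
    (h1 : ∀ (ν L a b : ℝ), 0 < ν → 0 < L → 0 < a → a < b → ∀ (u v p : ℝ → ℝ → ℝ → ℝ),
        IsStretchedLayerNSSolutionOn (Ioi 0) ν 1 1 L u v p → ExpTails (Icc a b) u v →
          ∫⁻ t in Ioc a b, layerDissipation ν L (u t) (v t) ≠ ∞ ∧
          L * (∫⁻ t in Ioc a b, layerDissipation ν L (u t) (v t)).toReal =
            (∫ t in a..b, strainWork L (u t) (v t)) -
              (excessEnergy L (u b) (v b) - excessEnergy L (u a) (v a)))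
    (h2a : ∀ (L C k : ℝ), 0 < L → 0 < k → ∀ (u v : ℝ → ℝ → ℝ),
        ContDiff ℝ 2 (fun q : ℝ × ℝ => u q.1 q.2) → ContDiff ℝ 2 (fun q : ℝ × ℝ => v q.1 q.2) →
        (∀ x y, dX u x y + dY v x y = 0) →
        (∀ x y, u (x + L) y = u x y) → (∀ x y, v (x + L) y = v x y) →
        SliceTails C k u v →
          strainWork L u v = -strainMoment L u v)
    (h2b : ∀ (L C k : ℝ), 0 < L → 0 < k → ∀ (u v : ℝ → ℝ → ℝ),
        ContDiff ℝ 2 (fun q : ℝ × ℝ => u q.1 q.2) → ContDiff ℝ 2 (fun q : ℝ × ℝ => v q.1 q.2) →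
        (∀ x y, dX u x y + dY v x y = 0) →
        (∀ x y, u (x + L) y = u x y) → (∀ x y, v (x + L) y = v x y) →
        (∀ x, Tendsto (fun y => u x y) atTop (𝓝 (1 / 2))) →
        (∀ x, Tendsto (fun y => u x y) atBot (𝓝 (-(1 / 2)))) →
        (∀ x, Tendsto (fun y => v x y) atTop (𝓝 0)) →
        (∀ x, Tendsto (fun y => v x y) atBot (𝓝 0)) →
        SliceTails C k u v →
          strainMoment L u v = -(1 / 2) * pairForm L (vorticity u v))
    (h3 : ∀ (ν L : ℝ), 0 < ν → 0 < L → ∀ (θ₁ θ₂ : ℝ → ℝ → ℝ), IsAdmissible L θ₁ θ₂ →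
        ∀ (u v p : ℝ → ℝ → ℝ → ℝ), InCruxClass ν L θ₁ θ₂ u v p →
          (∀ T : ℝ, 0 < T → ∫⁻ t in Ioc 0 T, layerDissipation ν L (u t) (v t) ≠ ∞) →
            ∀ a b : ℝ, 0 < a → a < b → ExpTails (Icc a b) u v)
    (h4 : ∀ (ν L : ℝ), 0 < ν → 0 < L → ∀ (θ₁ θ₂ : ℝ → ℝ → ℝ), IsAdmissible L θ₁ θ₂ →
        ∀ (u v p : ℝ → ℝ → ℝ → ℝ), InCruxClass ν L θ₁ θ₂ u v p →
          (∀ T : ℝ, 0 < T → ∫⁻ t in Ioc 0 T, layerDissipation ν L (u t) (v t) ≠ ∞) →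
          (∀ a b : ℝ, 0 < a → a < b → ExpTails (Icc a b) u v) →
            ∀ ε : ℝ, 0 < ε → ∀ᶠ T in atTop, excessEnergy L (u T) (v T) ≤ ε * T)
    (h5 : ∃ c : ℝ, 0 < c ∧ ∀ L : ℝ, 0 < L → ∃ ν₀ : ℝ, 0 < ν₀ ∧ ∃ θ₁ θ₂ : ℝ → ℝ → ℝ,
        IsAdmissible L θ₁ θ₂ ∧
        ∀ ν : ℝ, 0 < ν → ν ≤ ν₀ → ∀ (u v p : ℝ → ℝ → ℝ → ℝ), InCruxClass ν L θ₁ θ₂ u v p →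
          (∀ T : ℝ, 0 < T → ∫⁻ t in Ioc 0 T, layerDissipation ν L (u t) (v t) ≠ ∞) →
          (∀ a b : ℝ, 0 < a → a < b → ExpTails (Icc a b) u v) →
            ∀ ε : ℝ, 0 < ε → ∀ᶠ T in atTop,
              (L * (c * min L 1) - ε) * T ≤
                ∫ t in (1:ℝ)..T, (1 / 2) * pairForm L (vorticity (u t) (v t))) :
    StrainedLayerLaw := by
  obtain ⟨c, hc, hfloor⟩ := h5
  refine ⟨c, hc, ?_⟩
  intro L hL
  obtain ⟨ν₀, hν₀, θ₁, θ₂, hθ, hmain⟩ := hfloor L hL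
  refine ⟨ν₀, hν₀, θ₁, θ₂, hθ.1, hθ.2.1, hθ.2.2.1, hθ.2.2.2.1, hθ.2.2.2.2, ?_⟩
  intro ν hν hνle u v p
  show InCruxClass ν L θ₁ θ₂ u v p → ENNReal.ofReal (c * min L 1) ≤ meanLayerDissipation ν L u v
  intro hcl
  have hsol : IsStretchedLayerNSSolutionOn (Ioi 0) ν 1 1 L u v p := hcl.isSolution
  refine floorTransfer L (c * min L 1) (fun t => layerDissipation ν L (u t) (v t))
    (fun t => strainWork L (u t) (v t)) (fun t => excessEnergy L (u t) (v t)) hL ?_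
  intro hfin
  have htails : ∀ a b : ℝ, 0 < a → a < b → ExpTails (Icc a b) u v :=
    h3 ν L hν hL θ₁ θ₂ hθ u v p hcl hfin
  refine ⟨?_, ?_, ?_⟩
  · intro T hT
    exact (h1 ν L 1 T hν hL one_pos hT u v p hsol (htails 1 T one_pos hT)).2
  · intro ε hε
    filter_upwards [hmain ν hν hνle u v p hcl hfin htails ε hε, eventually_gt_atTop 1] with T hT hT1
    have hJ : (∫ t in (1:ℝ)..T, strainWork L (u t) (v t)) =
        ∫ t in (1:ℝ)..T, (1 / 2) * pairForm L (vorticity (u t) (v t)) := by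
      apply intervalIntegral.integral_congr
      intro t ht
      rw [uIcc_of_le hT1.le] at ht
      obtain ⟨C, k, hk, hCk⟩ := htails 1 T one_pos hT1
      have ht0 : t ∈ Ioi (0:ℝ) := lt_of_lt_of_le one_pos ht.1
      have hST : SliceTails C k (u t) (v t) := (hCk t ht).1
      have e1 := h2a L C k hL hk (u t) (v t) (hsol.contDiff_u ht0) (hsol.contDiff_v ht0)
        (hsol.divFree t ht0) (hsol.periodic_u t ht0) (hsol.periodic_v t ht0) hST
      have e2 := h2b L C k hL hk (u t) (v t) (hsol.contDiff_u ht0) (hsol.contDiff_v ht0)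
        (hsol.divFree t ht0) (hsol.periodic_u t ht0) (hsol.periodic_v t ht0)
        (hsol.tendsto_u_atTop t ht0) (hsol.tendsto_u_atBot t ht0) (hsol.tendsto_v_atTop t ht0)
        (hsol.tendsto_v_atBot t ht0) hST
      show strainWork L (u t) (v t) = (1 / 2) * pairForm L (vorticity (u t) (v t))
      rw [e1, e2]
      ring
    rw [hJ]
    exact hT
  · exact h4 ν L hν hL θ₁ θ₂ hθ u v p hcl hfin htails

end Summit.AnomalousDissipation.AnomalousDissipation.Theorems.StrainedLayerLaw.StrainWorkSumRule

end
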